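import Literature.NumberTheory.NumberFields.EisensteinFieldSelmer
import Literature.NumberTheory.NumberFields.EisensteinFieldPrimes
import HarnessLib

/-!
# `K(S, 3)` of `ℚ(ζ₃)` for `S = {λ, 2, 5, 11}`: normal forms `±ζ^i λ^j 2^k 5^l 11^m w³` and their local data

Topic `NumberTheory/NumberFields`. Sequel of `EisensteinFieldSelmer.lean` (the case `S = {λ, 2, 5}`,
for the `√−3`-descent on the cubic twists `y² = x³ + (2^a 5^b)²`). For the `√−3`-descent on the
Mordell curve `y² = x³ + 55²` (`55 = 5 · 11`, both primes `≡ 2 (mod 3)`, i.e. inert in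
`𝓞 K3 = ℤ[ζ₃]`) the descent values have cube valuations away from `2 · 3 · 5 · 11 = 330`, and the
finite group they generate is made explicit here:

* `K3.prime_natCast_eleven`: `11 ≡ 2 (mod 3)` is prime (inert) in `𝓞 K3`
  (Ireland–Rosen, Prop. 9.1.4); `associated_of_prime_of_dvd_330`: a prime element dividing `330`
  is associated to `λ`, `2`, `5` or `11`;
* `K3.exists_normal_form_330`: if `3 ∣ ord_v(b)` for all finite places `v ∌ 330` of `K3`, then
  `b = s ζ^i (ζ − 1)^j 2^k 5^l 11^m w³` with `s = ±1`, `i, j, k, l, m < 3`, `w ≠ 0` — the `K(S, n)` of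
  class number one (Silverman *AEC* Prop. VIII.1.6 / X.4.9; the tree's
  `exists_eq_unit_mul_prod_pow_mul_pow`);
* the valuations of such a normal form at `λ`, `2`, `5`, `11` (`−j`, `−k`, `−l`, `−m` modulo `3`:
  `log_vL_normalForm330`, `log_val2_normalForm330`, `log_val5_normalForm330`, `log_val11_normalForm330`)
  and the extraction lemmas `j/k/l/m_eq_zero_of_dvd_330`;
* for `j = 0`, the cubic residue character of the `2`-unit part: `χ₂ = i` (`chi2_normalForm330`;
  `χ₂(ζ) = 1`, `χ₂(ℚˣ) = 0`);
* its class modulo cubes `[ζ^i λ^j 2^k 5^l 11^m]` (`cubeClass_normalForm330`).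

## References

* J. H. Silverman, *The Arithmetic of Elliptic Curves*, 2nd ed., GTM 106 (2009), Prop. VIII.1.6,
  Prop. X.4.9, Exercise 10.9. [SilvermanAEC2009]
* K. Ireland, M. Rosen, *A Classical Introduction to Modern Number Theory*, 2nd ed., GTM 84
  (1990), Ch. 9 §1 (Prop. 9.1.4: rational primes `≡ 2 (mod 3)` are inert in `ℤ[ω]`), §3 (the cubic
  residue character). [IrelandRosen1990]
* H. Cohen, F. Pazuki, *Elementary 3-descent with a 3-isogeny*, Acta Arith. 140 (2009) 369–404,
  §2 (the groups `K(S,3)` in the `3`-descent). [CohenPazuki2009]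
-/

noncomputable section

open QuadraticAlgebra NumberField IsDedekindDomain IsDedekindDomain.HeightOneSpectrum
open WithZero (log exp)
open scoped WithZero
open Literature.NumberTheory.EllipticCurves.MordellDescent (cubeClass CubeUnits cubeClass_mul
  cubeClass_neg cubeClass_mul_pow_three cubeClass_eq_cubeClass_iff)

namespace Literature.NumberTheory.NumberFields

namespace K3

/-! ### The prime `11` -/

/-- **`11 ≡ 2 (mod 3)` is prime (inert) in `𝓞 ℚ(ζ₃)`.** [cite: IrelandRosen1990, Prop. 9.1.4] -/
theorem prime_eleven : Prime (11 : 𝓞 K3) := by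
  have h := prime_natCast_of_mod_three_eq_two (p := 11) (by decide) (by decide)
  simpa using h

/-- `11` is prime in `𝓞 K3` (cast from `ℕ`). [cite: IrelandRosen1990, Prop. 9.1.4] -/
theorem prime_natCast_eleven : Prime ((11 : ℕ) : 𝓞 K3) := by simpa using prime_eleven

/-- **A prime element of `𝓞 K3` dividing `330 = 30 · 11` is associated to `λ`, `2`, `5` or `11`.**
[cite: IrelandRosen1990, Prop. 9.1.4] -/
theorem associated_of_prime_of_dvd_330 {q : 𝓞 K3} (hq : Prime q) (h : q ∣ 330) :
    Associated q lamInt ∨ Associated q 2 ∨ Associated q 5 ∨ Associated q 11 := by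
  have h330 : (330 : 𝓞 K3) = 30 * 11 := by norm_num
  rw [h330] at h
  rcases hq.dvd_or_dvd h with h30 | h11
  · rcases associated_of_prime_of_dvd_thirty hq h30 with h | h | h
    · exact Or.inl h
    · exact Or.inr (Or.inl h)
    · exact Or.inr (Or.inr (Or.inl h))
  · exact Or.inr (Or.inr (Or.inr (hq.irreducible.associated_of_dvd prime_eleven.irreducible h11)))

/-! ### The normal form -/

/-- `((11 : 𝓞 K3) : K3) = 11`. [folklore] -/
private theorem algebraMap_eleven : algebraMap (𝓞 K3) K3 11 = 11 := map_ofNat _ 11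

/-- Every prime element dividing `330` is associated to one of `λ, 2, 5, 11`. [folklore] -/
private theorem gens330_spec (q : 𝓞 K3) (hq : Prime q) (h : q ∣ 330) :
    ∃ i, Associated q ((![lamInt, 2, 5, 11] : Fin 4 → 𝓞 K3) i) := by
  rcases associated_of_prime_of_dvd_330 hq h with h | h | h | h
  · exact ⟨0, h⟩
  · exact ⟨1, h⟩
  · exact ⟨2, h⟩
  · exact ⟨3, h⟩

/-- **Normal form of `K(S, 3)`, `S = {λ, 2, 5, 11}`**: if `b ∈ K3ˣ` has `3 ∣ ord_v(b)` for every
finite place `v ∌ 330`, then `b = s ζ^i (ζ − 1)^j 2^k 5^l 11^m w³` with `s = ±1`,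
`i, j, k, l, m < 3`, `w ≠ 0`. [cite: SilvermanAEC2009, Prop. VIII.1.6 (proof)] -/
theorem exists_normal_form_330 {b : K3} (hb : b ≠ 0)
    (hval : ∀ v : HeightOneSpectrum (𝓞 K3), (330 : 𝓞 K3) ∉ v.asIdeal →
      (3 : ℤ) ∣ log (v.valuation K3 b)) :
    ∃ (s : ℤ) (i j k l m : ℕ) (w : K3), (s = 1 ∨ s = -1) ∧ i < 3 ∧ j < 3 ∧ k < 3 ∧ l < 3 ∧ m < 3 ∧
      w ≠ 0 ∧ b = s * zeta ^ i * (zeta - 1) ^ j * 2 ^ k * 5 ^ l * 11 ^ m * w ^ 3 := by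
  obtain ⟨u, e, w, he, hw, h⟩ := exists_eq_unit_mul_prod_pow_mul_pow (K := K3) 330
    (![lamInt, 2, 5, 11] : Fin 4 → 𝓞 K3) gens330_spec (n := 3) (by norm_num) hb hval
  obtain ⟨s, i, hs, hi, hu⟩ := exists_coe_unit_eq u
  refine ⟨s, i, e 0, e 1, e 2, e 3, w, hs, hi, he 0, he 1, he 2, he 3, hw, ?_⟩
  rw [h, Fin.prod_univ_four, hu]
  simp only [Matrix.cons_val_zero, Matrix.cons_val_one, Matrix.cons_val, coe_lamInt,
    algebraMap_two, algebraMap_five, algebraMap_eleven]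
  ring

/-! ### Valuations of a normal form -/

section Valuations

variable {s : ℤ} (hs : s = 1 ∨ s = -1) (i j k l m : ℕ) {w : K3} (hw : w ≠ 0)
include hs hw

/-- A normal form is non-zero. [cite: SilvermanAEC2009, Prop. X.4.9] -/
theorem normalForm330_ne_zero :
    (s : K3) * zeta ^ i * (zeta - 1) ^ j * 2 ^ k * 5 ^ l * 11 ^ m * w ^ 3 ≠ 0 := by
  have hs0 : (s : K3) ≠ 0 := by rcases hs with rfl | rfl <;> norm_num
  have hz : (zeta : K3) ≠ 0 := isPrimitiveRoot_zeta.ne_zero (by norm_num)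
  exact mul_ne_zero (mul_ne_zero (mul_ne_zero (mul_ne_zero (mul_ne_zero (mul_ne_zero hs0
    (pow_ne_zero _ hz)) (pow_ne_zero _ zeta_sub_one_ne_zero)) (pow_ne_zero _ two_ne_zero))
    (pow_ne_zero _ (by norm_num))) (pow_ne_zero _ (by norm_num))) (pow_ne_zero _ hw)

/-- Generic valuation of a normal form at a prime element `q` (additivity of `ord_q`). [cite: SilvermanAEC2009, Prop. X.4.9] -/
theorem log_val_normalForm330 {q : 𝓞 K3} (hq : Prime q) :
    log (val hq ((s : K3) * zeta ^ i * (zeta - 1) ^ j * 2 ^ k * 5 ^ l * 11 ^ m * w ^ 3)) =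
      j * log (val hq (zeta - 1)) + k * log (val hq 2) + l * log (val hq 5) + m * log (val hq 11) +
        3 * log (val hq w) := by
  have hs0 : (s : K3) ≠ 0 := by rcases hs with rfl | rfl <;> norm_num
  have hz : (zeta : K3) ≠ 0 := isPrimitiveRoot_zeta.ne_zero (by norm_num)
  have h1 : (s : K3) * zeta ^ i ≠ 0 := mul_ne_zero hs0 (pow_ne_zero _ hz)
  have h2 : (s : K3) * zeta ^ i * (zeta - 1) ^ j ≠ 0 := mul_ne_zero h1 (pow_ne_zero _ zeta_sub_one_ne_zero)
  have h3 : (s : K3) * zeta ^ i * (zeta - 1) ^ j * 2 ^ k ≠ 0 := mul_ne_zero h2 (pow_ne_zero _ two_ne_zero)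
  have h4 : (s : K3) * zeta ^ i * (zeta - 1) ^ j * 2 ^ k * 5 ^ l ≠ 0 :=
    mul_ne_zero h3 (pow_ne_zero _ (by norm_num))
  have h5 : (s : K3) * zeta ^ i * (zeta - 1) ^ j * 2 ^ k * 5 ^ l * 11 ^ m ≠ 0 :=
    mul_ne_zero h4 (pow_ne_zero _ (by norm_num))
  rw [Valuation.log_map_mul _ h5 (pow_ne_zero _ hw), Valuation.log_map_mul _ h4 (pow_ne_zero _ (by norm_num)),
    Valuation.log_map_mul _ h3 (pow_ne_zero _ (by norm_num)), Valuation.log_map_mul _ h2 (pow_ne_zero _ two_ne_zero),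
    Valuation.log_map_mul _ h1 (pow_ne_zero _ zeta_sub_one_ne_zero), Valuation.log_map_mul _ hs0 (pow_ne_zero _ hz),
    Valuation.log_map_pow, Valuation.log_map_pow, Valuation.log_map_pow, Valuation.log_map_pow,
    Valuation.log_map_pow, Valuation.log_map_pow, log_val_sign hq hs, log_val_zeta hq]
  ring

/-- **At `λ`**: `log vL = −j + 3 log vL(w)`. [cite: SilvermanAEC2009, Prop. X.4.9] -/
theorem log_vL_normalForm330 :
    log (vL ((s : K3) * zeta ^ i * (zeta - 1) ^ j * 2 ^ k * 5 ^ l * 11 ^ m * w ^ 3)) = -j + 3 * log (vL w) := by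
  rw [vL, log_val_normalForm330 hs i j k l m hw prime_lamInt, ← coe_lamInt, log_val_self,
    show (2 : K3) = ((2 : ℕ) : K3) by norm_num, log_val_lam_natCast (by norm_num),
    show (5 : K3) = ((5 : ℕ) : K3) by norm_num, log_val_lam_natCast (by norm_num),
    show (11 : K3) = ((11 : ℕ) : K3) by norm_num, log_val_lam_natCast (by norm_num)]
  ring

/-- **At `2`**: `log val₂ = −k + 3 log val₂(w)`. [cite: SilvermanAEC2009, Prop. X.4.9] -/
theorem log_val2_normalForm330 :
    log (val prime_natCast_two ((s : K3) * zeta ^ i * (zeta - 1) ^ j * 2 ^ k * 5 ^ l * 11 ^ m * w ^ 3)) =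
      -k + 3 * log (val prime_natCast_two w) := by
  rw [log_val_normalForm330 hs i j k l m hw prime_natCast_two, log_val_zeta_sub_one,
    show (2 : K3) = ((2 : ℕ) : K3) by norm_num, log_val_natCast_self,
    show (5 : K3) = ((5 : ℕ) : K3) by norm_num, log_val_natCast_of_not_dvd _ (by norm_num),
    show (11 : K3) = ((11 : ℕ) : K3) by norm_num, log_val_natCast_of_not_dvd _ (by norm_num)]
  ring

/-- **At `5`**: `log val₅ = −l + 3 log val₅(w)`. [cite: SilvermanAEC2009, Prop. X.4.9] -/
theorem log_val5_normalForm330 :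
    log (val prime_natCast_five ((s : K3) * zeta ^ i * (zeta - 1) ^ j * 2 ^ k * 5 ^ l * 11 ^ m * w ^ 3)) =
      -l + 3 * log (val prime_natCast_five w) := by
  rw [log_val_normalForm330 hs i j k l m hw prime_natCast_five, log_val_zeta_sub_one,
    show (2 : K3) = ((2 : ℕ) : K3) by norm_num, log_val_natCast_of_not_dvd _ (by norm_num),
    show (5 : K3) = ((5 : ℕ) : K3) by norm_num, log_val_natCast_self,
    show (11 : K3) = ((11 : ℕ) : K3) by norm_num, log_val_natCast_of_not_dvd _ (by norm_num)]
  ring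

/-- **At `11`**: `log val₁₁ = −m + 3 log val₁₁(w)`. [cite: SilvermanAEC2009, Prop. X.4.9] -/
theorem log_val11_normalForm330 :
    log (val prime_natCast_eleven ((s : K3) * zeta ^ i * (zeta - 1) ^ j * 2 ^ k * 5 ^ l * 11 ^ m * w ^ 3)) =
      -m + 3 * log (val prime_natCast_eleven w) := by
  haveI : Fact (Nat.Prime 11) := ⟨by decide⟩
  rw [log_val_normalForm330 hs i j k l m hw prime_natCast_eleven, log_val_zeta_sub_one,
    show (2 : K3) = ((2 : ℕ) : K3) by norm_num, log_val_natCast_of_not_dvd _ (by norm_num),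
    show (5 : K3) = ((5 : ℕ) : K3) by norm_num, log_val_natCast_of_not_dvd _ (by norm_num),
    show (11 : K3) = ((11 : ℕ) : K3) by norm_num, log_val_natCast_self]
  ring

/-- `3 ∣ log vL ⟹ j = 0` (`j < 3`). [cite: SilvermanAEC2009, Prop. X.4.9] -/
theorem j_eq_zero_of_dvd_330 (hj : j < 3)
    (h : (3 : ℤ) ∣ log (vL ((s : K3) * zeta ^ i * (zeta - 1) ^ j * 2 ^ k * 5 ^ l * 11 ^ m * w ^ 3))) :
    j = 0 := by
  rw [log_vL_normalForm330 hs i j k l m hw] at h; omega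

/-- `3 ∣ log val₂ ⟹ k = 0` (`k < 3`). [cite: SilvermanAEC2009, Prop. X.4.9] -/
theorem k_eq_zero_of_dvd_330 (hk : k < 3)
    (h : (3 : ℤ) ∣ log (val prime_natCast_two
      ((s : K3) * zeta ^ i * (zeta - 1) ^ j * 2 ^ k * 5 ^ l * 11 ^ m * w ^ 3))) : k = 0 := by
  rw [log_val2_normalForm330 hs i j k l m hw] at h; omega

/-- `3 ∣ log val₅ ⟹ l = 0` (`l < 3`). [cite: SilvermanAEC2009, Prop. X.4.9] -/
theorem l_eq_zero_of_dvd_330 (hl : l < 3)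
    (h : (3 : ℤ) ∣ log (val prime_natCast_five
      ((s : K3) * zeta ^ i * (zeta - 1) ^ j * 2 ^ k * 5 ^ l * 11 ^ m * w ^ 3))) : l = 0 := by
  rw [log_val5_normalForm330 hs i j k l m hw] at h; omega

/-- `3 ∣ log val₁₁ ⟹ m = 0` (`m < 3`). [cite: SilvermanAEC2009, Prop. X.4.9] -/
theorem m_eq_zero_of_dvd_330 (hm : m < 3)
    (h : (3 : ℤ) ∣ log (val prime_natCast_eleven
      ((s : K3) * zeta ^ i * (zeta - 1) ^ j * 2 ^ k * 5 ^ l * 11 ^ m * w ^ 3))) : m = 0 := by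
  rw [log_val11_normalForm330 hs i j k l m hw] at h; omega

end Valuations

/-! ### The residue character at `2` of a normal form with `j = 0` -/

section Characters

variable {s : ℤ} (hs : s = 1 ∨ s = -1) (i k l m : ℕ) {w : K3} (hw : w ≠ 0)
include hs hw

/-- **`χ₂` of a normal form** (`j = 0`): `χ₂ = i` (`χ₂(ζ) = 1`, `χ₂(ℚˣ) = 0`, `χ₂(w³) = 0`).
[cite: IrelandRosen1990, Ch. 9 §3] -/
theorem chi2_normalForm330 : chi2 ((s : K3) * zeta ^ i * 2 ^ k * 5 ^ l * 11 ^ m * w ^ 3) = i := by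
  have hs0 : (s : K3) ≠ 0 := by rcases hs with rfl | rfl <;> norm_num
  have hz : (zeta : K3) ≠ 0 := isPrimitiveRoot_zeta.ne_zero (by norm_num)
  have H := cubicChar_mul_two
  have R := cubicChar_ratCast_two
  have h1 : (s : K3) * zeta ^ i ≠ 0 := mul_ne_zero hs0 (pow_ne_zero _ hz)
  have h3 : (s : K3) * zeta ^ i * 2 ^ k ≠ 0 := mul_ne_zero h1 (pow_ne_zero _ two_ne_zero)
  have h4 : (s : K3) * zeta ^ i * 2 ^ k * 5 ^ l ≠ 0 := mul_ne_zero h3 (pow_ne_zero _ (by norm_num))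
  have h5 : (s : K3) * zeta ^ i * 2 ^ k * 5 ^ l * 11 ^ m ≠ 0 := mul_ne_zero h4 (pow_ne_zero _ (by norm_num))
  rw [chi2, chi_mul _ H h5 (pow_ne_zero _ hw), chi_mul _ H h4 (pow_ne_zero _ (by norm_num)),
    chi_mul _ H h3 (pow_ne_zero _ (by norm_num)), chi_mul _ H h1 (pow_ne_zero _ two_ne_zero),
    chi_mul _ H hs0 (pow_ne_zero _ hz), chi_intCast _ R, chi_pow _ H hz, chi_pow_three _ H hw,
    show (2 : K3) = ((2 : ℕ) : K3) by norm_num, chi_pow _ H (by norm_num), chi_natCast _ R,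
    show (5 : K3) = ((5 : ℕ) : K3) by norm_num, chi_pow _ H (by norm_num), chi_natCast _ R,
    show (11 : K3) = ((11 : ℕ) : K3) by norm_num, chi_pow _ H (by norm_num), chi_natCast _ R,
    ← chi2, chi2_zeta]
  ring

end Characters

/-! ### Classes modulo cubes -/

/-- **The class of a normal form**: `[s ζ^i λ^j 2^k 5^l 11^m w³] = [ζ^i λ^j 2^k 5^l 11^m]`.
[cite: SilvermanAEC2009, Prop. X.4.9] -/
theorem cubeClass_normalForm330 {s : ℤ} (hs : s = 1 ∨ s = -1) (i j k l m : ℕ) {w : K3} (hw : w ≠ 0) :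
    cubeClass ((s : K3) * zeta ^ i * (zeta - 1) ^ j * 2 ^ k * 5 ^ l * 11 ^ m * w ^ 3) =
      cubeClass (zeta ^ i * (zeta - 1) ^ j * 2 ^ k * 5 ^ l * 11 ^ m : K3) := by
  have hz : (zeta : K3) ≠ 0 := isPrimitiveRoot_zeta.ne_zero (by norm_num)
  have hm : (zeta ^ i * (zeta - 1) ^ j * 2 ^ k * 5 ^ l * 11 ^ m : K3) ≠ 0 :=
    mul_ne_zero (mul_ne_zero (mul_ne_zero (mul_ne_zero (pow_ne_zero _ hz)
      (pow_ne_zero _ zeta_sub_one_ne_zero)) (pow_ne_zero _ two_ne_zero)) (pow_ne_zero _ (by norm_num)))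
      (pow_ne_zero _ (by norm_num))
  rw [show (s : K3) * zeta ^ i * (zeta - 1) ^ j * 2 ^ k * 5 ^ l * 11 ^ m * w ^ 3 =
      (s * (zeta ^ i * (zeta - 1) ^ j * 2 ^ k * 5 ^ l * 11 ^ m)) * w ^ 3 by ring,
    cubeClass_mul_pow_three (mul_ne_zero (by rcases hs with rfl | rfl <;> norm_num) hm) hw]
  rcases hs with rfl | rfl
  · rw [Int.cast_one, one_mul]
  · rw [Int.cast_neg, Int.cast_one, neg_one_mul, cubeClass_neg]

/-- **The `27` classes of the `√−3`-Selmer box for `y² = x³ + 55²`**: a normal form with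
`i = j = 0` has class `[2^k 5^l 11^m]`, the class of a RATIONAL number `2^k 5^l 11^m`.
[cite: CohenPazuki2009, §2] -/
theorem cubeClass_normalForm330_of_i_j_eq_zero {s : ℤ} (hs : s = 1 ∨ s = -1) (k l m : ℕ) {w : K3}
    (hw : w ≠ 0) :
    cubeClass ((s : K3) * zeta ^ 0 * (zeta - 1) ^ 0 * 2 ^ k * 5 ^ l * 11 ^ m * w ^ 3) =
      cubeClass (((2 ^ k * 5 ^ l * 11 ^ m : ℚ) : K3)) := by
  rw [cubeClass_normalForm330 hs 0 0 k l m hw, pow_zero, pow_zero, one_mul, one_mul]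
  congr 1
  push_cast
  ring

end K3

end Literature.NumberTheory.NumberFields
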